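import Mathlib
import Summits.NavierStokesRegularity.NavierStokesRegularity.Theorems.WakeRatchetTailRatchetRelayFront
import Summits.NavierStokesRegularity.NavierStokesRegularity.Theorems.WakeRatchetTailRatchetRelayLinearResponse
import Summits.NavierStokesRegularity.NavierStokesRegularity.Theorems.WakeRatchetTailRatchetRelayBranch
import Summits.NavierStokesRegularity.NavierStokesRegularity.Theorems.WakeRatchetTailRatchet.Negative.TailRatchetFalseOfDyadicScalarFronts
import Literature.Analysis.FluidPDE.Tao2016AveragedNS.BoundedEternalSolutions
import Literature.Analysis.FluidPDE.Tao2016AveragedNS.RenormalisedCascadeWaves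
import HarnessLib

/-!
# `WakeRatchet.TailRatchet` (stmt-NavierStokesRegularity-21808): exact scalar dyadic DSS fronts exist at
# EVERY sufficiently large scale ratio — `DyadicScalarFronts` holds on a whole neighbourhood of `ε₀ = ∞`

Support file for the crux `TailRatchet` (route `WakeRatchet`; MODEL lattice ODEs of Tao 2016 §1.2, §4 —
nothing in this file is a statement about the Navier–Stokes equations, and no item is closed here).

Context (census of stmt-21808, programme R-lac, continuation in `s`).  The lacunary branch `s ↦ δ_s`
(`…RelayFront`, unique by `…RelayFrontUnique`) is Lipschitz on `[2 − 10⁻²⁶, σ]` for every `σ < 2`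
(`…RelayBranch.branch_lipschitz`), tends to `0` at `s = 2` (`|δ_s| ≤ 8K(2−s)`), and is positive at
`s₀ = 2 − η₀` (`…RelayLinearResponse`).  By the intermediate value theorem every drain parameter
`δ ∈ (0, δ_{s₀}]` is attained, i.e. every base `Λ = δ^{-1/2} ≥ Λ*` carries an exact front:

* `branch_continuousOn` — continuity of `s ↦ δ_s` on `[2 − η₀, 2]` for a chosen branch;
* `dyadicScalarFronts_all_large` — **there is `E` such that for EVERY `ε₀ ≥ E` the four clauses of
  `WakeRatchetDyadicFront.DyadicScalarFronts` hold at `ε₀`** (some `s ∈ (1,2)`, some non-zero integrable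
  bounded-near-`0⁻` solution `a` of `a' = (Λ/s²)a(t/s)² − (s/Λ)a(t)a(st)`, `Λ = bigLam ε₀`).

So the construction item's matrix holds on a full neighbourhood of the LACUNARY end; what `TailRatchet`'s
refutation needs is the opposite end `ε₀ → 0`, which stays open (programme R-glob/R-cont of the census).

HONEST FRAMING: MODEL lattice only; nothing about Navier–Stokes; the crux stays open.
-/

noncomputable section

set_option linter.dupNamespace false

namespace Summit.NavierStokesRegularity.NavierStokesRegularity.Theorems

namespace WakeRatchetLacunaryFrontAll

open Set Filter Topology MeasureTheory
open Literature.Analysis.FluidPDE Literature.Analysis.FluidPDE.TaoCascade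
open WakeRatchetRelayFront WakeRatchetRelayLinearResponse WakeRatchetRelayBranch

/-- **EXACT SCALAR DYADIC DSS FRONTS AT EVERY LARGE SCALE RATIO.**  There is `E > 0` such that for every
`ε₀ ≥ E` there are a time ratio `s ∈ (1, 2)` and a real function `a` — non-zero, integrable on `(−∞,0)`,
bounded near `0⁻` — solving the scalar front equation of the inviscid dyadic chain
`a'(t) = (Λ/s²)a(t/s)² − (s/Λ)a(t)a(st)` on `t < 0` with `Λ = bigLam ε₀`: the four clauses of
`WakeRatchetDyadicFront.DyadicScalarFronts`, at EVERY sufficiently large `ε₀` (intermediate value theorem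
along the continuous lacunary branch `s ↦ δ_s`, `Λ = δ_s^{-1/2}`).
[cite: Tao2016AveragedNS, §1.2 (dyadic Katz–Pavlović model); cell vocabulary (`DyadicScalarFronts`, `bigLam`; programme R-lac of the census of stmt-21808)] -/
theorem dyadicScalarFronts_all_large :
    ∃ E : ℝ, 0 < E ∧ ∀ ε₀ : ℝ, E ≤ ε₀ → ∃ s : ℝ, 1 < s ∧ ∃ a : ℝ → ℝ,
      (∀ t : ℝ, t < 0 → HasDerivAt a
        (bigLam ε₀ / s ^ 2 * a (t / s) ^ 2 - s / bigLam ε₀ * a t * a (s * t)) t) ∧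
      IntegrableOn a (Iio 0) ∧
      (∃ t₀ : ℝ, t₀ < 0 ∧ ∃ P : ℝ, ∀ t : ℝ, t₀ ≤ t → t < 0 → |a t| ≤ P) ∧
      ∃ t : ℝ, t < 0 ∧ a t ≠ 0 := by
  -- the branch: a choice of front at every `s ∈ [2 − 10⁻²⁶, 2]`
  have H := fun (s : ℝ) (h1 : 2 - 1 / 10 ^ 26 ≤ s) (h2 : s ≤ 2) => relay_front_exists h1 h2
  choose! δf hf hcont hh0 hhρ hδle hfront hsecond using H
  obtain ⟨η₁, hη₁, hresp⟩ := linear_response_lower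
  -- the left end `s₀ = 2 − η₀`
  set η₀ : ℝ := min η₁ (1 / (2 * 10 ^ 26)) with hη₀
  have hη₀pos : 0 < η₀ := lt_min hη₁ (by norm_num)
  have hη₀1 : η₀ ≤ 1 / (2 * 10 ^ 26) := min_le_right _ _
  have hη₀2 : η₀ ≤ η₁ := min_le_left _ _
  set s₀ : ℝ := 2 - η₀ with hs₀
  have hs₀1 : 2 - 1 / 10 ^ 26 ≤ s₀ := by
    have : (1 : ℝ) / (2 * 10 ^ 26) ≤ 1 / 10 ^ 26 := by norm_num
    rw [hs₀]; linarith
  have hs₀2 : s₀ ≤ 2 := by rw [hs₀]; linarith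
  have hs₀lt : s₀ < 2 := by rw [hs₀]; linarith
  -- positivity at `s₀`
  set δ₀ : ℝ := δf s₀ with hδ₀
  have hδ₀pos : 0 < δ₀ := by
    have h1 := (abs_le.1 (hsecond s₀ hs₀1 hs₀2)).1
    have h2 := hresp s₀ (by rw [hs₀]; linarith) hs₀2
    have h3 : (2 : ℝ) - s₀ = η₀ := by rw [hs₀]; ring
    rw [h3] at h1 h2
    have h4 : (10 : ℝ) ^ 22 * η₀ ^ 2 ≤ η₀ / 20000 := by
      rw [show (10 : ℝ) ^ 22 * η₀ ^ 2 = (10 ^ 22 * η₀) * η₀ by ring, div_eq_mul_inv, mul_comm η₀]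
      exact mul_le_mul_of_nonneg_right (by nlinarith) hη₀pos.le
    rw [hδ₀]; nlinarith
  have hδ₀lt : δ₀ < 1 := by
    have h1 := (abs_le.1 (hδle s₀ hs₀1 hs₀2)).2
    have : (8800000 : ℝ) * (2 - s₀) < 1 := by rw [hs₀]; nlinarith
    linarith
  -- value at `2`
  have hδ2 : δf 2 = 0 := by
    have h1 := hδle 2 (by norm_num) le_rfl
    rw [sub_self, mul_zero] at h1
    exact abs_eq_zero.1 (le_antisymm h1 (abs_nonneg _))
  -- continuity of the branch on `[s₀, 2]`
  have hcontδ : ContinuousOn δf (Icc s₀ 2) := by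
    intro x hx
    rw [Metric.continuousWithinAt_iff]
    intro ε hε
    rcases eq_or_lt_of_le hx.2 with hx2 | hx2
    · -- at `x = 2`: `|δ_y| ≤ 8K(2−y)`
      refine ⟨ε / 8800000, by positivity, fun y hy hdist => ?_⟩
      rw [hx2, hδ2, Real.dist_eq, sub_zero]
      have h1 := hδle y (le_trans hs₀1 hy.1) hy.2
      rw [hx2, Real.dist_eq, abs_sub_comm, abs_of_nonneg (by linarith [hy.2])] at hdist
      calc |δf y| ≤ 8800000 * (2 - y) := h1
        _ < ε := by
          have := (lt_div_iff₀ (by norm_num : (0 : ℝ) < 8800000)).1 hdist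
          linarith
    · -- at `x < 2`: Lipschitz bound with `σ = (x + 2)/2`
      set σ : ℝ := (x + 2) / 2 with hσ
      have hσlt : σ < 2 := by rw [hσ]; linarith
      have hxσ : x < σ := by rw [hσ]; linarith
      set Lσ : ℝ := 2200000 * (1334 + 64 * (1 / (2 - σ))) with hLσ
      have hq : 0 < 1 / (2 - σ) := one_div_pos.2 (by linarith)
      have hLσpos : 0 < Lσ := by rw [hLσ]; exact mul_pos (by norm_num) (by linarith)
      refine ⟨min (σ - x) (ε / Lσ), lt_min (by linarith) (by positivity), fun y hy hdist => ?_⟩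
      have hd1 : dist y x < σ - x := lt_of_lt_of_le hdist (min_le_left _ _)
      have hd2 : dist y x < ε / Lσ := lt_of_lt_of_le hdist (min_le_right _ _)
      have hyσ : y ≤ σ := by
        rw [Real.dist_eq] at hd1
        have := (abs_lt.1 hd1).2; linarith
      have hL := (branch_lipschitz (le_trans hs₀1 hy.1) (le_trans hs₀1 hx.1) hyσ hxσ.le hσlt
        (hcont y (le_trans hs₀1 hy.1) hy.2) (hcont x (le_trans hs₀1 hx.1) hx.2)
        (hh0 y (le_trans hs₀1 hy.1) hy.2) (hh0 x (le_trans hs₀1 hx.1) hx.2)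
        (hhρ y (le_trans hs₀1 hy.1) hy.2) (hhρ x (le_trans hs₀1 hx.1) hx.2)
        (hδle y (le_trans hs₀1 hy.1) hy.2) (hδle x (le_trans hs₀1 hx.1) hx.2)
        (hfront y (le_trans hs₀1 hy.1) hy.2) (hfront x (le_trans hs₀1 hx.1) hx.2)).1
      rw [Real.dist_eq]
      rw [Real.dist_eq] at hd2
      calc |δf y - δf x| ≤ Lσ * |y - x| := by rw [hLσ]; exact hL
        _ < Lσ * (ε / Lσ) := mul_lt_mul_of_pos_left hd2 hLσpos
        _ = ε := by field_simp
  -- intermediate values: every `δ ∈ [0, δ₀]` is attained on `[s₀, 2]`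
  have hIVT : Icc (δf 2) (δf s₀) ⊆ δf '' Icc s₀ 2 := intermediate_value_Icc' hs₀2 hcontδ
  rw [hδ2] at hIVT
  -- the threshold `E = (1/δ₀)^{1/5}`
  set E : ℝ := (1 / δ₀) ^ ((1 : ℝ) / 5) with hE
  have hinv : 1 < 1 / δ₀ := by rw [lt_div_iff₀ hδ₀pos]; linarith
  have hEpos : 0 < E := by rw [hE]; positivity
  refine ⟨E, hEpos, fun ε₀ hε₀ => ?_⟩
  -- the base and the drain parameter
  have hε₀pos : 0 < ε₀ := lt_of_lt_of_le hEpos hε₀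
  set Λ : ℝ := bigLam ε₀ with hΛ
  have hΛpos : 0 < Λ := bigLam_pos (by linarith)
  have hΛE : (1 / δ₀) ^ ((1 : ℝ) / 2) ≤ Λ := by
    have h1 : E ^ ((5 : ℝ) / 2) ≤ (1 + ε₀) ^ ((5 : ℝ) / 2) :=
      Real.rpow_le_rpow hEpos.le (by linarith) (by norm_num)
    have h2 : E ^ ((5 : ℝ) / 2) = (1 / δ₀) ^ ((1 : ℝ) / 2) := by
      rw [hE, ← Real.rpow_mul (by positivity)]; norm_num
    rw [hΛ]; unfold bigLam; rw [← h2]; exact h1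
  set δ : ℝ := 1 / Λ ^ 2 with hδ
  have hδpos : 0 < δ := by rw [hδ]; positivity
  have hδle : δ ≤ δ₀ := by
    -- `Λ² ≥ 1/δ₀`
    have h1 : (1 / δ₀) ^ ((1 : ℝ) / 2) * (1 / δ₀) ^ ((1 : ℝ) / 2) = 1 / δ₀ := by
      rw [← Real.rpow_add (by positivity)]; norm_num
    have h0 : 0 ≤ (1 / δ₀) ^ ((1 : ℝ) / 2) := by positivity
    have h2 : 1 / δ₀ ≤ Λ ^ 2 := by
      rw [← h1, sq]; exact mul_le_mul hΛE hΛE h0 hΛpos.le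
    rw [hδ, div_le_iff₀ (by positivity)]
    have := (div_le_iff₀ hδ₀pos).1 h2
    linarith
  -- a time ratio realising `δ`
  obtain ⟨s, hsI, hseq⟩ := hIVT ⟨hδpos.le, hδle⟩
  have hs1 : 2 - 1 / 10 ^ 26 ≤ s := le_trans hs₀1 hsI.1
  have hs2 : s ≤ 2 := hsI.2
  have hslt : s < 2 := by
    rcases eq_or_lt_of_le hs2 with h | h
    · exfalso; rw [h, hδ2] at hseq; exact hδpos.ne hseq
    · exact h
  have hsgt : 1 < s := by
    have : (1 : ℝ) / 10 ^ 26 ≤ 1 / 2 := by norm_num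
    linarith
  have hs0 : 0 < s := by linarith
  -- the front at `s` with drain `δ = 1/Λ²`
  have hfr := hfront s hs1 hs2
  rw [hseq] at hfr
  set h : ℝ → ℝ := hf s with hh
  have hcont' := hcont s hs1 hs2
  have hhρ' := hhρ s hs1 hs2
  refine ⟨s, hsgt, fun t => 4 / Λ * (Real.exp t + hf s t), ?_, ?_, ?_, ?_⟩
  · -- the front equation, rescaled
    intro t ht
    have h1 := (hfr t ht).const_mul (4 / Λ)
    refine h1.congr_deriv ?_
    rw [hδ]
    field_simp
    ring
  · -- integrability
    have hexp : IntegrableOn (fun t : ℝ => Real.exp t) (Iio 0) :=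
      (integrableOn_exp_Iic 0).mono_set Iio_subset_Iic_self
    have hg : IntegrableOn (fun t : ℝ => 8800000 * (2 - s) * Real.exp (1 / 2 * t)) (Iio 0) :=
      ((integrableOn_exp_mul_Iic (by norm_num : (0 : ℝ) < 1 / 2) 0).mono_set
        Iio_subset_Iic_self).const_mul _
    have hhint : IntegrableOn (hf s) (Iio 0) := by
      refine Integrable.mono' hg ?_ ?_
      · exact (hcont'.mono Iio_subset_Iic_self).aestronglyMeasurable measurableSet_Iio
      · refine (ae_restrict_iff' measurableSet_Iio).2 (Eventually.of_forall fun t ht => ?_)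
        rw [Real.norm_eq_abs, show (1 : ℝ) / 2 * t = t / 2 by ring]
        exact hhρ' t (le_of_lt ht)
    exact (hexp.add hhint).const_mul _
  · -- bounded near `0⁻`
    refine ⟨-1, by norm_num, 4 / Λ * (1 + 8800000 * (2 - s)), fun t _ ht => ?_⟩
    have hC0 : 0 ≤ (8800000 : ℝ) * (2 - s) := by nlinarith
    have hht : |hf s t| ≤ 8800000 * (2 - s) := (hhρ' t ht.le).trans (by
      have : Real.exp (t / 2) ≤ 1 := Real.exp_le_one_iff.2 (by linarith)
      nlinarith)
    rw [abs_mul, abs_of_pos (by positivity : (0 : ℝ) < 4 / Λ)]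
    refine mul_le_mul_of_nonneg_left ?_ (by positivity)
    calc |Real.exp t + hf s t| ≤ |Real.exp t| + |hf s t| := abs_add_le _ _
      _ ≤ 1 + 8800000 * (2 - s) := by
          rw [abs_of_pos (Real.exp_pos t)]; linarith [Real.exp_le_one_iff.2 ht.le]
  · -- non-zero at `t = −1`
    refine ⟨-1, by norm_num, ?_⟩
    have hh1 : |hf s (-1)| ≤ 8800000 * (2 - s) * Real.exp (-1 / 2) := hhρ' (-1) (by norm_num)
    have hsmall : 8800000 * (2 - s) * Real.exp (-1 / 2) ≤ 1 / 10 := by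
      have h1 : Real.exp (-1 / 2 : ℝ) ≤ 1 := Real.exp_le_one_iff.2 (by norm_num)
      have h2 : (8800000 : ℝ) * (2 - s) ≤ 1 / 10 := by nlinarith
      have h3 : 0 ≤ (8800000 : ℝ) * (2 - s) := by nlinarith
      nlinarith
    have he : 1 / 3 < Real.exp (-1 : ℝ) := by
      rw [Real.exp_neg, lt_inv_comm₀ (by norm_num) (Real.exp_pos 1)]
      have := Real.exp_one_lt_d9; norm_num at this ⊢; linarith
    have hpos : 0 < Real.exp (-1) + hf s (-1) := by
      have := (abs_le.1 hh1).1; linarith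
    exact mul_ne_zero (by positivity) hpos.ne'

/-! ## Appendix (appended): DSS waves and bounded eternal solutions at every large scale ratio -/

/-- **NON-TRIVIAL ADMISSIBLE DSS WAVES OF THE DYADIC MEMBER AT EVERY LARGE `ε₀`.**  There is `E > 0` such
that for every `ε₀ ≥ E` the dyadic table carries a non-trivial admissible single-profile DSS blow-up wave
(tree dictionary `WakeRatchetDyadicFront.isDSSWave_dyadic_of_scalarFront` applied to
`dyadicScalarFronts_all_large`).
[cite: Tao2016AveragedNS, §1.2 (dyadic model), §4 Lemma 4.1 (4.8), §6.4; cell vocabulary (`IsDSSWave`, `dyadicTable`)] -/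
theorem dssWave_all_large :
    ∃ E : ℝ, 0 < E ∧ ∀ ε₀ : ℝ, E ≤ ε₀ → ∃ (T : ℝ) (Φ : Fin 1 → ℝ → Em 4),
      IsDSSWave ε₀ dyadicTable (1 : Equiv.Perm (Fin 1)) T Φ ∧ ∃ r x, Φ r x ≠ 0 := by
  obtain ⟨E, hE, H⟩ := dyadicScalarFronts_all_large
  refine ⟨E, hE, fun ε₀ hε₀ => ?_⟩
  have hε : 0 < ε₀ := lt_of_lt_of_le hE hε₀
  obtain ⟨s, hs, a, hode, hint, hbdd, t₁, ht₁, hne⟩ := H ε₀ hε₀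
  refine ⟨_, _, WakeRatchetDyadicFront.isDSSWave_dyadic_of_scalarFront hε hs hode hint hbdd, 0,
    -Real.log (-t₁), ?_⟩
  have ht : -Real.exp (-(-Real.log (-t₁))) = t₁ := by
    rw [neg_neg, Real.exp_log (neg_pos.2 ht₁), neg_neg]
  rw [ht]
  intro h0
  rw [smul_eq_zero] at h0
  rcases h0 with h0 | h0
  · exact (mul_ne_zero (Real.exp_pos _).ne' hne) h0
  · exact one_ne_zero ((PiLp.single_eq_zero_iff 2 (0 : Fin 4)).1 h0)

/-- **THE HYPOTHESIS CLASS OF THE K1 FAMILY IS NON-EMPTY AT EVERY LARGE `ε₀`.**  There is `E > 0` such that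
for every `ε₀ ≥ E` the dyadic member `dyadicTable ∈ E₂(2)` carries a NON-ZERO admissible eternal solution
obeying the uniform (type-I) bound.
[cite: Tao2016AveragedNS, §1.2 (dyadic model), §4 Lemma 4.1 (4.8), §6.4; cell vocabulary (`IsEternal`, `UniformBound`, `dssEmbed`)] -/
theorem bounded_eternal_all_large :
    ∃ E : ℝ, 0 < E ∧ ∀ ε₀ : ℝ, E ≤ ε₀ → ∃ W : ℤ → ℝ → Em 4,
      IsEternal ε₀ dyadicTable W ∧ UniformBound W ∧ ∃ n σ, W n σ ≠ 0 := by
  obtain ⟨E, hE, H⟩ := dssWave_all_large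
  refine ⟨E, hE, fun ε₀ hε₀ => ?_⟩
  obtain ⟨T, Φ, hW, r, x, hne⟩ := H ε₀ hε₀
  refine ⟨dssEmbed (1 : Equiv.Perm (Fin 1)) T Φ r, hW.isEternal_dssEmbed r, uniformBound_dssEmbed hW r,
    0, x, ?_⟩
  simpa [dssEmbed] using hne

end WakeRatchetLacunaryFrontAll

end Summit.NavierStokesRegularity.NavierStokesRegularity.Theorems

end
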